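import Literature.NumberTheory.Transcendental.RoySmallValueLevelHeights
import Literature.NumberTheory.Transcendental.RoySmallValueEstimatesTranslatesGcdProofs
import Literature.NumberTheory.Transcendental.RoySmallValueEstimatesProjPlaneProofs
import Literature.NumberTheory.Transcendental.RoySmallValueEstimatesAbsHeightProofs
import HarnessLib

/-!
# Small value estimates at rational translates (Nguyen–Roy 2016) — proofs, XXIII: the zero-cycle `W = 𝒵(P̃_D, Q)` of Proposition 14

Twenty-third proofs file towards `Literature.NumberTheory.Transcendental.nguyenRoy2016_thm_1`
(Nguyen–Roy, IJNT 12 (2016) = arXiv:1412.5163). Everything here is PROVED; no named facts. Source,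
proof of Proposition 14 (p. 11 of the arXiv text):

> Put `P = P̃_D` [...] By Lemma 13, the polynomials `P, Φ(P), …, Φ^D(P)` are relatively prime. So,
> as they are homogeneous of degree `D`, there exist integers `a₁, …, a_D` of absolute values at
> most `D` such that `Q := ∑_{i=1}^D aᵢ Φⁱ(P)` is relatively prime to `P`. Then, `W := 𝒵(P, Q)` has
> dimension `0`. So, it is a finite union of `ℚ`-subvarieties of `ℙ²(ℂ)` whose sum of the degrees
> is `deg(W) ≤ D²` and whose sum of the heights is `h(W) ≤ D log‖P‖ + D log‖Q‖ + O(D²)` [...]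
> Since `D ≤ T`, we have `τⁱ(Z) ⊆ W` for `i = 0, …, T − 1`.

This file attaches these objects to a level `D` of the Nguyen–Roy proof, in the vocabulary of the
two parallel developments it bridges: the elimination-free machinery of the Roy 2013 seat
(`Roy2013.royF = Φ(P, Q, ·)`, `ZeroConfigK`, the Gelfond–Mahler height bound
`sum_mul_height_le_log_length_of_complex`, the package `Roy2013.LevelPkg` of
`RoySmallValueLevels` whose companion form is Roy's `∑ tⁱ𝒟ⁱP̃`) and the projective plane /
absolute height of the Nguyen–Roy endgame (`NguyenRoy.PPt`, `tauMatPow`, `habs` of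
`RoySmallValueEstimatesProjPlaneProofs` / `…AbsHeightProofs`, feeding `NguyenRoy.EndgameData.prop14`).

* `PairPkg D P̃ Q̃` — the data attached to ANY pair of coprime integer forms of degree `D`
  (monomial complements `M₁, M₂` of `Φ` with `#M₂ = D²`, the normalised representatives `αᵢ`
  (`i < m ≤ D²`) of `𝒵(P̃, Q̃)(ℂ)`, algebraicity of their coordinates, the factorisation
  `Φ(P̃, Q̃, ·) = c ∏ ℓ_{αᵢ}^{eᵢ}` with exact multiplicities `eᵢ ≥ 1`, `∑ eᵢ = D²`) and
  `nonempty_pairPkg`: it exists (the proof of `Roy2013.nonempty_levelPkg` with the companion form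
  abstracted); `PairPkg.cfg` the induced `ZeroConfigK`; `intF`, `sum_e_mul_height_le'` — the
  height bound `∑ᵢ eᵢ D h_K(αᵢ) ≤ [K:ℚ](log N! + N₀ log‖P̃‖ + N₁ log‖Q̃‖)` ("`h(W) ≤ D log‖P‖ +
  D log‖Q‖ + O(D²)`", in the Weil-height currency of this development);
* the points `PairPkg.pt i ∈ ℙ²(ℂ)` of `W`: `pt_injective`, `exists_pt_eq` (every common zero is
  one of them), **`card_le_sq`** (`deg W ≤ D²`: a finite set of common zeros of `P̃, Q̃` in `ℙ²(ℂ)`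
  has at most `m ≤ D²` elements), `habs_pt` and **`mul_sum_habs_pt_le`**
  (`D ∑ᵢ h_abs(αᵢ) ≤ log 𝓛(Φ(P̃, Q̃, ·))`), `sum_habs_le` (the absolute heights of any finite set of
  common zeros add up to at most `∑ᵢ h_abs(αᵢ)`);
* the Nguyen–Roy companion `compQ D Qᵢ t = ∑_{i=1}^D tⁱ Qᵢ ∈ ℤ[X]_D` built from integral models
  `Qᵢ` of the translates `ΦⁱP̃` (as supplied by `NguyenRoy.prop4`), `map_compQ`
  (`= ∑ tⁱ Φⁱ P̃` over `ℂ`, `Φ = Roy2013.tau r s`), `isHomogeneous_map_compQ`,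
  **`exists_coprime_compQ`** (`t ≤ D²` with `gcd(P̃, Q) = 1`, from Lemma 13 via
  `exists_coprime_tau_combination_rat`), `maxNorm_map_compQ_le` (`‖Q‖ ≤ D (D²)^D max‖Qᵢ‖`);
* values at translates: `eval_tau_vec` (`(Φ_{ρ,θ}P)(v) = P(v₀, ρv₀ + v₁, θv₂)`), `eval_tau_pow`
  (`(ΦⁱP)(v) = P(τ̲ⁱv)` with `τ̲ⁱ = tauMatPow r s i`), `tauMatPow_mulVec_tauMatPow`, and
  **`common_zero_of_translates`**: if `P̃(τ̲ʲv) = 0` for `0 ≤ j < 2T` and `D ≤ T`, then `τ̲ⁱv` is a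
  common zero of `P̃` and `Q` for `0 ≤ i < T` ("`τⁱ(Z) ⊆ W` for `i = 0, …, T−1`").

With the orbit facts of `RoySmallValueEstimatesAlgPointProofs` (`conj`, `conj_tauA`, `card_conj`)
and the fixed points of `τᵏ` (`RoySmallValueEstimatesTauFixedPointsProofs`), Proposition 14 is
`card_le_sq` + `sum_habs_le` + `mul_sum_habs_pt_le` applied to the `T` translated orbits.

## References

* [NguyenRoy2016] N. A. V. Nguyen, D. Roy, IJNT 12 (2016) 1273–1293 = arXiv:1412.5163, §5,
  Proposition 14 and its proof (the cycle `W = 𝒵(P, Q)`, `deg W ≤ D²`, `h(W) ≤ …`, `τⁱZ ⊆ W`).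
* [Roy2013] D. Roy, *A small value estimate for 𝔾ₐ × 𝔾ₘ*, Mathematika 59 (2013), 333–363
  (arXiv:1301.0663), §6, proof of Proposition 6.4 (the same construction with `𝒟` for `Φ`).
-/

noncomputable section

open MvPolynomial Finset Module Height
open scoped Matrix

namespace Literature.NumberTheory.Transcendental

namespace NguyenRoy

open Roy2013
open Nesterenko hiding tau

/-! ### The package attached to a pair of coprime integer forms -/

/-- **The data attached to a pair `(P̃, Q̃)` of coprime integer forms of degree `D`**: the data
`(M₁, M₂, σ)` of the determinant `Φ`, the normalised representatives `αᵢ` of the points of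
`W = 𝒵(P̃, Q̃)`, the factorisation `Φ(P̃, Q̃, ·) = c ∏ ℓ_{αᵢ}^{eᵢ}`, with all the properties the
proof uses (`Roy2013.LevelPkg` is the case `Q̃ = ∑ tⁱ𝒟ⁱP̃`). A record; nothing is asserted — it is
shown to be inhabited below. [cite: NguyenRoy2016, proof of Proposition 14 (the cycle W = 𝒵(P, Q))] -/
structure PairPkg (D : ℕ) (Pt Qt : MvPolynomial (Fin 3) ℤ) where
  /-- monomial complements -/
  M₁ : Finset (Fin 3 →₀ ℕ)
  /-- monomial complements -/
  M₂ : Finset (Fin 3 →₀ ℕ)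
  /-- columns ↔ rows -/
  σ : PhiCol D M₁ M₂ ≃ PhiRow D
  /-- number of points of `𝒵(P̃, Q̃)` -/
  m : ℕ
  /-- normalised representatives -/
  α : Fin m → Fin 3 → ℂ
  /-- pivots -/
  piv : Fin m → Fin 3
  /-- leading constant of `F` -/
  c : ℂ
  /-- multiplicities -/
  e : Fin m → ℕ
  hP : (map (Int.castRingHom ℂ) Pt).IsHomogeneous D
  hQ : (map (Int.castRingHom ℂ) Qt).IsHomogeneous D
  hP0 : map (Int.castRingHom ℂ) Pt ≠ 0
  hQ0 : map (Int.castRingHom ℂ) Qt ≠ 0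
  hPQ : ∀ f : CX, map (Int.castRingHom ℂ) Qt * f ∈
    Ideal.span {map (Int.castRingHom ℂ) Pt} → f ∈ Ideal.span {map (Int.castRingHom ℂ) Pt}
  hM₁ : ∀ μ ∈ M₁, μ.degree = 2 * D
  hM₂ : ∀ μ ∈ M₂, μ.degree = 2 * D
  hE₁i : Submodule.span ℂ ((fun μ => monomial μ (1 : ℂ)) '' (M₁ : Set (Fin 3 →₀ ℕ))) ⊓
    (homogeneousSubmodule (Fin 3) ℂ D).map (LinearMap.mulLeft ℂ (map (Int.castRingHom ℂ) Pt)) = ⊥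
  hE₁s : Submodule.span ℂ ((fun μ => monomial μ (1 : ℂ)) '' (M₁ : Set (Fin 3 →₀ ℕ))) ⊔
    (homogeneousSubmodule (Fin 3) ℂ D).map (LinearMap.mulLeft ℂ (map (Int.castRingHom ℂ) Pt)) =
    homogeneousSubmodule (Fin 3) ℂ (2 * D)
  hE₂i : Submodule.span ℂ ((fun μ => monomial μ (1 : ℂ)) '' (M₂ : Set (Fin 3 →₀ ℕ))) ⊓
    ((homogeneousSubmodule (Fin 3) ℂ D).map (LinearMap.mulLeft ℂ (map (Int.castRingHom ℂ) Pt)) ⊔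
      (homogeneousSubmodule (Fin 3) ℂ D).map
        (LinearMap.mulLeft ℂ (map (Int.castRingHom ℂ) Qt))) = ⊥
  hE₂s : Submodule.span ℂ ((fun μ => monomial μ (1 : ℂ)) '' (M₂ : Set (Fin 3 →₀ ℕ))) ⊔
    ((homogeneousSubmodule (Fin 3) ℂ D).map (LinearMap.mulLeft ℂ (map (Int.castRingHom ℂ) Pt)) ⊔
      (homogeneousSubmodule (Fin 3) ℂ D).map
        (LinearMap.mulLeft ℂ (map (Int.castRingHom ℂ) Qt))) =
    homogeneousSubmodule (Fin 3) ℂ (2 * D)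
  hcard : M₂.card = D ^ 2
  hm : m ≤ D ^ 2
  piv_one : ∀ i, α i (piv i) = 1
  piv_min : ∀ i k, α i k ≠ 0 → piv i ≤ k
  zero : ∀ i, eval (α i) (map (Int.castRingHom ℂ) Pt) = 0 ∧
    eval (α i) (map (Int.castRingHom ℂ) Qt) = 0
  cov : ∀ β : Fin 3 → ℂ, β ≠ 0 → eval β (map (Int.castRingHom ℂ) Pt) = 0 →
    eval β (map (Int.castRingHom ℂ) Qt) = 0 → ∃ i, ∃ s : ℂ, β = s • α i
  sep : ∀ i j, i ≠ j → ¬∃ s : ℂ, α j = s • α i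
  alg : ∀ i k, IsAlgebraic ℚ (α i k)
  hc : c ≠ 0
  he1 : ∀ i, 1 ≤ e i
  hesum : ∑ i, e i = M₂.card
  hFeq : royF D M₁ M₂ σ (map (Int.castRingHom ℂ) Pt) (map (Int.castRingHom ℂ) Qt) =
    C c * ∏ i, evalForm D (α i) ^ e i
  hemax : ∀ i k, evalForm D (α i) ^ k ∣
    royF D M₁ M₂ σ (map (Int.castRingHom ℂ) Pt) (map (Int.castRingHom ℂ) Qt) → k ≤ e i

/-- **The package exists** for every pair of coprime integer forms `P̃, Q̃` of degree `D ≥ 1`.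
[cite: NguyenRoy2016, proof of Proposition 14; Roy2013, §6, proof of Prop. 6.4] -/
theorem nonempty_pairPkg {D : ℕ} (hD : 1 ≤ D) {Pt Qt : MvPolynomial (Fin 3) ℤ}
    (hPt : (map (Int.castRingHom ℂ) Pt).IsHomogeneous D)
    (hQt : (map (Int.castRingHom ℂ) Qt).IsHomogeneous D) (hPt0 : map (Int.castRingHom ℂ) Pt ≠ 0)
    (hrel : IsRelPrime (map (Int.castRingHom ℂ) Pt) (map (Int.castRingHom ℂ) Qt)) :
    Nonempty (PairPkg D Pt Qt) := by
  classical
  set P : CX := map (Int.castRingHom ℂ) Pt with hPdef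
  set Q : CX := map (Int.castRingHom ℂ) Qt with hQdef
  have hPQ : ∀ f : CX, Q * f ∈ Ideal.span {P} → f ∈ Ideal.span {P} := by
    intro f hf
    rw [Ideal.mem_span_singleton] at hf ⊢
    exact hrel.dvd_of_dvd_mul_left hf
  have hQ0 : Q ≠ 0 := by
    intro h0
    rw [h0] at hrel
    have hu : IsUnit P := isRelPrime_zero_right.mp hrel
    have h1 : P.totalDegree = 0 := by
      obtain ⟨u, hu'⟩ := hu
      have h2 := congrArg totalDegree (u.mul_inv)
      rw [totalDegree_mul_of_isDomain (Units.ne_zero u) (Units.ne_zero u⁻¹), totalDegree_one] at h2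
      rw [← hu']; omega
    rw [hPt.totalDegree hPt0] at h1
    omega
  -- the data of `Φ`
  obtain ⟨a, b, hab, hreg⟩ := exists_regular_lineForm_pow hPt hQt hD hPt0 hQ0 hPQ
  have hR : (lineForm a b ^ D).IsHomogeneous D := by
    simpa using (isHomogeneous_lineForm' a b).pow D
  obtain ⟨M₁, M₂, hM₁, hM₂, hE₁i, hE₁s, hE₂i, hE₂s, ⟨σ⟩⟩ :=
    exists_phi_data hPt hQt hR hPt0 hQ0 hPQ (hreg D)
  have hcard : M₂.card = D ^ 2 := card_eq_sq hPt hQt hPt0 hQ0 hPQ hE₂i hE₂s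
  -- the representatives, normalised
  obtain ⟨m, α₀, hm, hα₀0, hz₀, hsep₀, hcov₀⟩ := exists_common_zero_reprs hPt hQt hPt0 hQ0 hPQ
  obtain ⟨α, piv, s, hs, hαs, hpiv1, hpivmin⟩ := exists_normalised α₀ hα₀0
  have hα0 : ∀ i, α i ≠ 0 := fun i h => by
    have := hpiv1 i; rw [h, Pi.zero_apply] at this; exact zero_ne_one this
  have hz : ∀ i, eval (α i) P = 0 ∧ eval (α i) Q = 0 := fun i => by
    rw [hαs i, eval_smul_eq_zero_iff hPt (hs i), eval_smul_eq_zero_iff hQt (hs i)]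
    exact hz₀ i
  have hsep : ∀ i j, i ≠ j → ¬∃ r : ℂ, α j = r • α i := by
    rintro i j hij ⟨r, hr⟩
    refine hsep₀ i j hij ⟨(s j)⁻¹ * r * s i, ?_⟩
    have h1 : α₀ j = (s j)⁻¹ • α j := by
      rw [hαs j, smul_smul, inv_mul_cancel₀ (hs j), one_smul]
    rw [h1, hr, hαs i, smul_smul, smul_smul]
  have hcov : ∀ β : Fin 3 → ℂ, β ≠ 0 → eval β P = 0 → eval β Q = 0 → ∃ i, ∃ r : ℂ, β = r • α i := by
    intro β hβ hβP hβQ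
    obtain ⟨i, r, hr⟩ := hcov₀ β hβ hβP hβQ
    refine ⟨i, r * (s i)⁻¹, ?_⟩
    rw [hr, hαs i, smul_smul, mul_assoc, inv_mul_cancel₀ (hs i), mul_one]
  -- algebraicity of the coordinates
  have halg : ∀ i k, IsAlgebraic ℚ (α i k) := by
    intro i k
    have hPq : (map (Int.castRingHom ℚ) Pt).IsHomogeneous D := isHomogeneous_map_rat hPt
    have hQq : (map (Int.castRingHom ℚ) Qt).IsHomogeneous D := isHomogeneous_map_rat hQt
    have h1 : α i k = α₀ i k / α₀ i (piv i) := by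
      have hpk : α i (piv i) = 1 := hpiv1 i
      rw [hαs i] at hpk ⊢
      simp only [Pi.smul_apply, smul_eq_mul] at hpk ⊢
      have : s i = (α₀ i (piv i))⁻¹ := eq_inv_of_mul_eq_one_left hpk
      rw [this, inv_mul_eq_div]
    rw [h1]
    refine isAlgebraic_ratio_of_common_zero hPq hQq (by rw [toCX_map_int]; exact hPt0)
      (by rw [toCX_map_int]; exact hQ0) (by rw [toCX_map_int, toCX_map_int]; exact hPQ)
      (by rw [toCX_map_int]; exact (hz₀ i).1) (by rw [toCX_map_int]; exact (hz₀ i).2) ?_ k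
    intro h0
    have hpk : α i (piv i) = 1 := hpiv1 i
    rw [hαs i, Pi.smul_apply, smul_eq_mul, h0, mul_zero] at hpk
    exact zero_ne_one hpk
  -- the factorisation
  obtain ⟨c, e, hc, he1, hesum, hFeq, hemax⟩ := royF_eq_C_mul_prod hPt hQt hD hPt0 hQ0 hPQ hM₁ hM₂
    hE₁i hE₁s hE₂i hE₂s σ α hα0 hz hsep hcov
  exact ⟨⟨M₁, M₂, σ, m, α, piv, c, e, hPt, hQt, hPt0, hQ0, hPQ, hM₁, hM₂, hE₁i, hE₁s, hE₂i, hE₂s,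
    hcard, hm, hpiv1, hpivmin, hz, hcov, hsep, halg, hc, he1, hesum, hFeq, hemax⟩⟩

namespace PairPkg

variable {D : ℕ} {Pt Qt : MvPolynomial (Fin 3) ℤ} (L : PairPkg D Pt Qt)

/-- The representatives are non-zero. [folklore] -/
theorem α_ne_zero (i : Fin L.m) : L.α i ≠ 0 := fun h => by
  have := L.piv_one i; rw [h, Pi.zero_apply] at this; exact zero_ne_one this

/-- There is at least one point when `D ≥ 1` (`∑ e_i = D² ≥ 1`). [folklore] -/
theorem m_pos (hD : 1 ≤ D) : 0 < L.m := by
  by_contra h0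
  push Not at h0
  have hm0 : L.m = 0 := Nat.le_zero.mp h0
  have h1 : ∑ i, L.e i = 0 := by
    have : IsEmpty (Fin L.m) := by rw [hm0]; infer_instance
    exact Finset.sum_of_isEmpty _
  rw [L.hesum, L.hcard] at h1
  exact absurd h1 (pow_ne_zero 2 (by omega))

/-- **The induced configuration over a field `K` containing the coordinates.**
[cite: Roy2013, §6, proof of Prop. 6.4] -/
def cfg (K : IntermediateField ℚ ℂ) (hK : ∀ i k, L.α i k ∈ K) : ZeroConfigK K (Fin L.m) where
  α := L.α
  piv := L.piv
  P := map (Int.castRingHom ℚ) Pt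
  Q := map (Int.castRingHom ℚ) Qt
  piv_one := L.piv_one
  piv_min := L.piv_min
  mem := hK
  zero i := by rw [toCX_map_int, toCX_map_int]; exact L.zero i
  cov β hβ hP hQ := by
    rw [toCX_map_int] at hP hQ
    exact L.cov β hβ hP hQ
  sep := L.sep

/-- The configuration has the representatives of the package. [folklore] -/
@[simp] theorem cfg_α (K : IntermediateField ℚ ℂ) (hK : ∀ i k, L.α i k ∈ K) :
    (L.cfg K hK).α = L.α := rfl

/-- The finite set of all coordinates of the package. [folklore] -/
def coords : Finset ℂ := univ.image fun p : Fin L.m × Fin 3 => L.α p.1 p.2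

/-- Coordinates belong to `coords`. [folklore] -/
theorem mem_coords (i : Fin L.m) (k : Fin 3) : L.α i k ∈ L.coords :=
  mem_image.mpr ⟨(i, k), mem_univ _, rfl⟩

/-- `coords` consists of algebraic numbers. [folklore] -/
theorem isAlgebraic_of_mem_coords {x : ℂ} (hx : x ∈ L.coords) : IsAlgebraic ℚ x := by
  obtain ⟨p, -, rfl⟩ := mem_image.mp hx
  exact L.alg p.1 p.2

/-- All coordinates lie in the normal number field `closureField coords`. [folklore] -/
theorem mem_closureField_coords (i : Fin L.m) (k : Fin 3) : L.α i k ∈ closureField L.coords :=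
  mem_closureField (fun _ hx => L.isAlgebraic_of_mem_coords hx) (L.mem_coords i k)

/-! ### `F₀ = Φ(P̃, Q̃, ·)` with integer coefficients and the height of `W` -/

/-- `F₀ = Φ(P̃, Q̃, ·) ∈ ℤ[r]`. [cite: Roy2013, §2 ("`F` has integer coefficients")] -/
def intF : MvPolynomial (CoefIdx D) ℤ := royF D L.M₁ L.M₂ L.σ Pt Qt

/-- Unfolding. [folklore] -/
theorem intF_def : L.intF = royF D L.M₁ L.M₂ L.σ Pt Qt := rfl

/-- Its complexification is `Φ(P̃ ⊗ ℂ, Q̃ ⊗ ℂ, ·)`. [folklore] -/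
theorem map_intF : map (Int.castRingHom ℂ) L.intF =
    royF D L.M₁ L.M₂ L.σ (map (Int.castRingHom ℂ) Pt) (map (Int.castRingHom ℂ) Qt) := by
  rw [intF_def, map_royF]

/-- `F₀ ≠ 0`. [cite: Roy2013, §6, proof of Prop. 6.4] -/
theorem intF_ne_zero : L.intF ≠ 0 := by
  intro h0
  have h := L.hFeq
  rw [← map_intF, h0, map_zero] at h
  have hne : C L.c * ∏ i, evalForm D (L.α i) ^ L.e i ≠ 0 :=
    mul_ne_zero (by rw [Ne, C_eq_zero]; exact L.hc)
      (prod_ne_zero_iff.mpr fun i _ => pow_ne_zero _ (evalForm_ne_zero (L.α_ne_zero i)))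
  exact hne h.symm

/-- `𝓛(F₀) ≥ 1` (a non-zero integer polynomial). [folklore] -/
theorem one_le_length_intF : 1 ≤ ∑ n ∈ L.intF.support, |((coeff n L.intF : ℤ) : ℝ)| := by
  obtain ⟨n, hn⟩ := MvPolynomial.ne_zero_iff.mp L.intF_ne_zero
  have hn' : n ∈ L.intF.support := mem_support_iff.mpr hn
  have h1 : (1 : ℝ) ≤ |((coeff n L.intF : ℤ) : ℝ)| := by
    have h : ((1 : ℤ) : ℝ) ≤ ((|coeff n L.intF| : ℤ) : ℝ) := Int.cast_le.mpr (Int.one_le_abs hn)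
    rw [Int.cast_one, Int.cast_abs] at h
    exact h
  exact h1.trans (single_le_sum (f := fun n => |((coeff n L.intF : ℤ) : ℝ)|)
    (fun _ _ => abs_nonneg _) hn')

/-- `𝓛(F₀) ≤ N! ‖P̃‖^{N₀} ‖Q̃‖^{N₁}`. [cite: Roy2013, §6, proof of Prop. 6.4 (`‖F‖ ≤ N!‖P‖^N‖Q‖^N`)] -/
theorem length_intF_le :
    ∑ n ∈ L.intF.support, |((coeff n L.intF : ℤ) : ℝ)| ≤
      (Fintype.card (PhiRow D)).factorial *
        (maxNorm (map (Int.castRingHom ℂ) Pt) ^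
            Fintype.card ↥(finsuppAntidiag (univ : Finset (Fin 3)) (2 * D)) *
          maxNorm (map (Int.castRingHom ℂ) Qt) ^ Fintype.card ↥L.M₁) := by
  rw [← l1Norm_map_intCast, map_intF]
  exact l1Norm_royF_le L.σ _ _

variable (K : IntermediateField ℚ ℂ) (hK : ∀ i k, L.α i k ∈ K)

/-- The embedding composed with the `K`-representatives gives back the complex points. [folklore] -/
theorem val_comp_rep (i : Fin L.m) :
    ((algebraMap K ℂ : K →+* ℂ) ∘ (L.cfg K hK).rep i : Fin 3 → ℂ) = L.α i :=
  funext fun _ => rfl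

/-- The complex factorisation rewritten with the `K`-representatives. [folklore] -/
theorem map_intF_eq_prod :
    map (Int.castRingHom ℂ) L.intF =
      C L.c * ∏ i, evalForm D ((algebraMap K ℂ : K →+* ℂ) ∘ (L.cfg K hK).rep i) ^ L.e i := by
  rw [map_intF]
  simp only [val_comp_rep]
  exact L.hFeq

variable [NumberField K]

/-- **`∑ᵢ eᵢ · D · h_K(rep i) ≤ [K:ℚ] · log 𝓛(F₀)`** ("the sum of the heights of the components of
`W` is at most …", Weil-height form). [cite: NguyenRoy2016, proof of Proposition 14 (`h(W) ≤ …`);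
Roy2013, Prop. 2.2 (ii)] -/
theorem sum_e_mul_height_le :
    ∑ i, (L.e i : ℝ) * (D * logHeight ((L.cfg K hK).rep i)) ≤
      Module.finrank ℚ K * Real.log (∑ n ∈ L.intF.support, |((coeff n L.intF : ℤ) : ℝ)|) :=
  sum_mul_height_le_log_length_of_complex (algebraMap K ℂ : K →+* ℂ)
    (fun i => (L.cfg K hK).rep_ne_zero i) L.intF_ne_zero (L.map_intF_eq_prod K hK)

/-- **The height bound in closed form**: `∑ᵢ eᵢ D h_K(rep i) ≤ [K:ℚ] (log N! + N₀ log M_P + N₁ log M_Q)`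
whenever `‖P̃‖ ≤ M_P`, `‖Q̃‖ ≤ M_Q` with `M_P, M_Q ≥ 1`.
[cite: NguyenRoy2016, proof of Proposition 14 (`h(W) ≤ D log‖P‖ + D log‖Q‖ + O(D²)`)] -/
theorem sum_e_mul_height_le' {MP MQ : ℝ} (hMP : 1 ≤ MP) (hMQ : 1 ≤ MQ)
    (hPn : maxNorm (map (Int.castRingHom ℂ) Pt) ≤ MP)
    (hQn : maxNorm (map (Int.castRingHom ℂ) Qt) ≤ MQ) :
    ∑ i, (L.e i : ℝ) * (D * logHeight ((L.cfg K hK).rep i)) ≤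
      Module.finrank ℚ K * (Real.log (Fintype.card (PhiRow D)).factorial +
        Fintype.card ↥(finsuppAntidiag (univ : Finset (Fin 3)) (2 * D)) * Real.log MP +
        Fintype.card ↥L.M₁ * Real.log MQ) := by
  have h1 := L.sum_e_mul_height_le K hK
  have hlen := L.length_intF_le
  have hlen1 := L.one_le_length_intF
  have hn : (0 : ℝ) ≤ Module.finrank ℚ K := Nat.cast_nonneg _
  refine h1.trans (mul_le_mul_of_nonneg_left ?_ hn)
  obtain ⟨N, hN⟩ : ∃ N : ℕ, N = Fintype.card (PhiRow D) := ⟨_, rfl⟩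
  obtain ⟨N₀, hN₀⟩ : ∃ N₀ : ℕ, N₀ = Fintype.card ↥(finsuppAntidiag (univ : Finset (Fin 3)) (2 * D)) :=
    ⟨_, rfl⟩
  obtain ⟨N₁, hN₁⟩ : ∃ N₁ : ℕ, N₁ = Fintype.card ↥L.M₁ := ⟨_, rfl⟩
  rw [← hN, ← hN₀, ← hN₁] at hlen ⊢
  have hfact : (0 : ℝ) < (N.factorial : ℝ) := Nat.cast_pos.mpr (Nat.factorial_pos N)
  have hMP0 : 0 < MP := lt_of_lt_of_le one_pos hMP
  have hMQ0 : 0 < MQ := lt_of_lt_of_le one_pos hMQ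
  have hP0 : 0 ≤ maxNorm (map (Int.castRingHom ℂ) Pt) := maxNorm_nonneg _
  have hQ0 : 0 ≤ maxNorm (map (Int.castRingHom ℂ) Qt) := maxNorm_nonneg _
  have hpowP : maxNorm (map (Int.castRingHom ℂ) Pt) ^ N₀ ≤ MP ^ N₀ := pow_le_pow_left₀ hP0 hPn N₀
  have hpowQ : maxNorm (map (Int.castRingHom ℂ) Qt) ^ N₁ ≤ MQ ^ N₁ := pow_le_pow_left₀ hQ0 hQn N₁
  have hlen2 : ∑ n ∈ L.intF.support, |((coeff n L.intF : ℤ) : ℝ)| ≤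
      (N.factorial : ℝ) * (MP ^ N₀ * MQ ^ N₁) := by
    refine hlen.trans (mul_le_mul_of_nonneg_left ?_ hfact.le)
    exact mul_le_mul hpowP hpowQ (pow_nonneg hQ0 _) (pow_nonneg hMP0.le _)
  have hpos1 : (0 : ℝ) < MP ^ N₀ := pow_pos hMP0 _
  have hpos2 : (0 : ℝ) < MQ ^ N₁ := pow_pos hMQ0 _
  calc Real.log (∑ n ∈ L.intF.support, |((coeff n L.intF : ℤ) : ℝ)|)
      ≤ Real.log ((N.factorial : ℝ) * (MP ^ N₀ * MQ ^ N₁)) :=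
        Real.log_le_log (lt_of_lt_of_le one_pos hlen1) hlen2
    _ = Real.log (N.factorial : ℝ) + N₀ * Real.log MP + N₁ * Real.log MQ := by
        rw [Real.log_mul hfact.ne' (mul_pos hpos1 hpos2).ne', Real.log_mul hpos1.ne' hpos2.ne',
          Real.log_pow, Real.log_pow, add_assoc]

end PairPkg

/-! ### The points of `W` in `ℙ²(ℂ)`, their number and their absolute heights -/

/-- A homogeneous form vanishes at the chosen representative of `[v]` iff it vanishes at `v`.
[folklore] -/
theorem eval_rep_mk_eq_zero_iff {P : CX} {n : ℕ} (hP : P.IsHomogeneous n) {v : V3} (hv : v ≠ 0) :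
    eval (Projectivization.mk ℂ v hv).rep P = 0 ↔ eval v P = 0 := by
  obtain ⟨a, ha⟩ := Projectivization.exists_smul_eq_mk_rep ℂ v hv
  rw [← ha]
  change eval ((a : ℂ) • v) P = 0 ↔ eval v P = 0
  exact eval_smul_eq_zero_iff hP (Units.ne_zero a) v

namespace PairPkg

variable {D : ℕ} {Pt Qt : MvPolynomial (Fin 3) ℤ} (L : PairPkg D Pt Qt)

/-- **The points `[αᵢ] ∈ ℙ²(ℂ)` of `W = 𝒵(P̃, Q̃)`.** [cite: NguyenRoy2016, proof of Proposition 14] -/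
def pt (i : Fin L.m) : PPt := Projectivization.mk ℂ (L.α i) (L.α_ne_zero i)

/-- Distinct indices give distinct points. [cite: NguyenRoy2016, proof of Proposition 14] -/
theorem pt_injective : Function.Injective L.pt := by
  intro i j hij
  by_contra hne
  rw [pt, pt, Projectivization.mk_eq_mk_iff] at hij
  obtain ⟨a, ha⟩ := hij
  exact L.sep j i (Ne.symm hne) ⟨(a : ℂ), ha.symm⟩

/-- **Every common zero of `P̃, Q̃` in `ℙ²(ℂ)` is one of the points `[αᵢ]`.**
[cite: NguyenRoy2016, proof of Proposition 14 (`W = 𝒵(P, Q)` has dimension 0)] -/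
theorem exists_pt_eq {v : V3} (hv : v ≠ 0) (hPv : eval v (map (Int.castRingHom ℂ) Pt) = 0) (hQv : eval v (map (Int.castRingHom ℂ) Qt) = 0) :
    ∃ i, Projectivization.mk ℂ v hv = L.pt i := by
  obtain ⟨i, t, ht⟩ := L.cov v hv hPv hQv
  have ht0 : t ≠ 0 := by
    rintro rfl
    exact hv (by rw [ht, zero_smul])
  refine ⟨i, ?_⟩
  rw [pt, Projectivization.mk_eq_mk_iff]
  exact ⟨Units.mk0 t ht0, by rw [Units.smul_mk0]; exact ht.symm⟩

/-- The same for a point of `ℙ²(ℂ)` given with its chosen representative. [folklore] -/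
theorem exists_eq_pt {p : PPt} (hPp : eval p.rep (map (Int.castRingHom ℂ) Pt) = 0) (hQp : eval p.rep (map (Int.castRingHom ℂ) Qt) = 0) :
    ∃ i, p = L.pt i := by
  obtain ⟨i, hi⟩ := L.exists_pt_eq p.rep_nonzero hPp hQp
  exact ⟨i, by rw [← hi, Projectivization.mk_rep]⟩

/-- **`deg W ≤ D²`**: a finite set of common zeros of `P̃, Q̃` in `ℙ²(ℂ)` has at most `m ≤ D²`
elements. [cite: NguyenRoy2016, proof of Proposition 14 (`deg(W) ≤ D²`)] -/
theorem card_le (S : Finset PPt) (hS : ∀ p ∈ S, eval p.rep (map (Int.castRingHom ℂ) Pt) = 0 ∧ eval p.rep (map (Int.castRingHom ℂ) Qt) = 0) :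
    S.card ≤ L.m := by
  classical
  have hsub : S ⊆ univ.image L.pt := by
    intro p hp
    obtain ⟨i, rfl⟩ := L.exists_eq_pt (hS p hp).1 (hS p hp).2
    exact mem_image_of_mem _ (mem_univ _)
  calc S.card ≤ (univ.image L.pt).card := card_le_card hsub
    _ ≤ (univ : Finset (Fin L.m)).card := card_image_le
    _ = L.m := by rw [card_univ, Fintype.card_fin]

/-- `deg W ≤ D²`, numerically. [cite: NguyenRoy2016, proof of Proposition 14 (`deg(W) ≤ D²`)] -/
theorem card_le_sq (L : PairPkg D Pt Qt) (S : Finset PPt) (hS : ∀ p ∈ S, eval p.rep (map (Int.castRingHom ℂ) Pt) = 0 ∧ eval p.rep (map (Int.castRingHom ℂ) Qt) = 0) :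
    S.card ≤ D ^ 2 :=
  (card_le L S hS).trans L.hm

/-- The absolute height of the point `[αᵢ]` is `h_K(rep i)/[K:ℚ]` for any number field `K ⊆ ℂ`
containing its (normalised) coordinates. [cite: NguyenRoy2016, §4 (`h_abs`)] -/
theorem habs_pt (K : IntermediateField ℚ ℂ) (hK : ∀ i k, L.α i k ∈ K) [NumberField K]
    (i : Fin L.m) : habs (L.pt i) = logHeight ((L.cfg K hK).rep i) / finrank ℚ K :=
  habs_mk (algebraMap K ℂ : K →+* ℂ) ((L.cfg K hK).rep i) (L.α_ne_zero i)

/-- **`D ∑ᵢ h_abs([αᵢ]) ≤ log 𝓛(Φ(P̃, Q̃, ·))`** — the sum of the (absolute Weil) heights of the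
points of `W`. [cite: NguyenRoy2016, proof of Proposition 14 (`h(W) ≤ D log‖P‖ + D log‖Q‖ + O(D²)`)] -/
theorem mul_sum_habs_pt_le :
    (D : ℝ) * ∑ i, habs (L.pt i) ≤ Real.log (∑ n ∈ L.intF.support, |((coeff n L.intF : ℤ) : ℝ)|) := by
  classical
  set K : IntermediateField ℚ ℂ := closureField L.coords with hKdef
  have hK : ∀ i k, L.α i k ∈ K := L.mem_closureField_coords
  have h1 := L.sum_e_mul_height_le K hK
  have hn : (0 : ℝ) < finrank ℚ K := Nat.cast_pos.mpr finrank_pos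
  -- drop the multiplicities `e_i ≥ 1`
  have h2 : ∑ i, (D * logHeight ((L.cfg K hK).rep i)) ≤
      ∑ i, (L.e i : ℝ) * (D * logHeight ((L.cfg K hK).rep i)) := by
    refine sum_le_sum fun i _ => ?_
    have he : (1 : ℝ) ≤ L.e i := by exact_mod_cast L.he1 i
    have h0 : 0 ≤ (D : ℝ) * logHeight ((L.cfg K hK).rep i) :=
      mul_nonneg (Nat.cast_nonneg _) (logHeight_nonneg _)
    nlinarith
  have h3 : (D : ℝ) * ∑ i, habs (L.pt i) =
      (∑ i, (D * logHeight ((L.cfg K hK).rep i))) / finrank ℚ K := by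
    rw [mul_sum, sum_div]
    refine sum_congr rfl fun i _ => ?_
    rw [L.habs_pt K hK i, mul_div_assoc]
  rw [h3, div_le_iff₀ hn, mul_comm]
  exact h2.trans h1

/-- **The absolute heights of any finite set of common zeros of `P̃, Q̃` add up to at most
`∑ᵢ h_abs([αᵢ])`.** [cite: NguyenRoy2016, proof of Proposition 14 (`∑ h(τⁱZ) ≤ h(W)`)] -/
theorem sum_habs_le (S : Finset PPt) (hS : ∀ p ∈ S, eval p.rep (map (Int.castRingHom ℂ) Pt) = 0 ∧ eval p.rep (map (Int.castRingHom ℂ) Qt) = 0) :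
    ∑ p ∈ S, habs p ≤ ∑ i, habs (L.pt i) := by
  classical
  have hsub : S ⊆ univ.image L.pt := by
    intro p hp
    obtain ⟨i, rfl⟩ := L.exists_eq_pt (hS p hp).1 (hS p hp).2
    exact mem_image_of_mem _ (mem_univ _)
  calc ∑ p ∈ S, habs p ≤ ∑ p ∈ univ.image L.pt, habs p :=
        sum_le_sum_of_subset_of_nonneg hsub fun p _ _ => habs_nonneg p
    _ = ∑ i, habs (L.pt i) := by
        rw [sum_image fun i _ j _ h => L.pt_injective h]

/-- The two bounds combined: `D ∑_{p ∈ S} h_abs(p) ≤ log 𝓛(F₀)` for common zeros.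
[cite: NguyenRoy2016, proof of Proposition 14] -/
theorem mul_sum_habs_le (S : Finset PPt)
    (hS : ∀ p ∈ S, eval p.rep (map (Int.castRingHom ℂ) Pt) = 0 ∧ eval p.rep (map (Int.castRingHom ℂ) Qt) = 0) :
    (D : ℝ) * ∑ p ∈ S, habs p ≤ Real.log (∑ n ∈ L.intF.support, |((coeff n L.intF : ℤ) : ℝ)|) :=
  (mul_le_mul_of_nonneg_left (L.sum_habs_le S hS) (Nat.cast_nonneg _)).trans L.mul_sum_habs_pt_le

/-- The same with the closed-form bound on `log 𝓛(F₀)`.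
[cite: NguyenRoy2016, proof of Proposition 14 (`h(W) ≤ D log‖P‖ + D log‖Q‖ + O(D²)`)] -/
theorem mul_sum_habs_le' (S : Finset PPt)
    (hS : ∀ p ∈ S, eval p.rep (map (Int.castRingHom ℂ) Pt) = 0 ∧ eval p.rep (map (Int.castRingHom ℂ) Qt) = 0) {MP MQ : ℝ} (hMP : 1 ≤ MP)
    (hMQ : 1 ≤ MQ) (hPn : maxNorm (map (Int.castRingHom ℂ) Pt) ≤ MP)
    (hQn : maxNorm (map (Int.castRingHom ℂ) Qt) ≤ MQ) :
    (D : ℝ) * ∑ p ∈ S, habs p ≤ Real.log (Fintype.card (PhiRow D)).factorial +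
        Fintype.card ↥(finsuppAntidiag (univ : Finset (Fin 3)) (2 * D)) * Real.log MP +
        Fintype.card ↥L.M₁ * Real.log MQ := by
  refine (L.mul_sum_habs_le S hS).trans ?_
  have hlen := L.length_intF_le
  have hlen1 := L.one_le_length_intF
  obtain ⟨N, hN⟩ : ∃ N : ℕ, N = Fintype.card (PhiRow D) := ⟨_, rfl⟩
  obtain ⟨N₀, hN₀⟩ : ∃ N₀ : ℕ, N₀ = Fintype.card ↥(finsuppAntidiag (univ : Finset (Fin 3)) (2 * D)) :=
    ⟨_, rfl⟩
  obtain ⟨N₁, hN₁⟩ : ∃ N₁ : ℕ, N₁ = Fintype.card ↥L.M₁ := ⟨_, rfl⟩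
  rw [← hN, ← hN₀, ← hN₁] at hlen ⊢
  have hfact : (0 : ℝ) < (N.factorial : ℝ) := Nat.cast_pos.mpr (Nat.factorial_pos N)
  have hMP0 : 0 < MP := lt_of_lt_of_le one_pos hMP
  have hMQ0 : 0 < MQ := lt_of_lt_of_le one_pos hMQ
  have hP0 : 0 ≤ maxNorm (map (Int.castRingHom ℂ) Pt) := maxNorm_nonneg _
  have hQ0 : 0 ≤ maxNorm (map (Int.castRingHom ℂ) Qt) := maxNorm_nonneg _
  have hpowP : maxNorm (map (Int.castRingHom ℂ) Pt) ^ N₀ ≤ MP ^ N₀ := pow_le_pow_left₀ hP0 hPn N₀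
  have hpowQ : maxNorm (map (Int.castRingHom ℂ) Qt) ^ N₁ ≤ MQ ^ N₁ := pow_le_pow_left₀ hQ0 hQn N₁
  have hlen2 : ∑ n ∈ L.intF.support, |((coeff n L.intF : ℤ) : ℝ)| ≤
      (N.factorial : ℝ) * (MP ^ N₀ * MQ ^ N₁) := by
    refine hlen.trans (mul_le_mul_of_nonneg_left ?_ hfact.le)
    exact mul_le_mul hpowP hpowQ (pow_nonneg hQ0 _) (pow_nonneg hMP0.le _)
  have hpos1 : (0 : ℝ) < MP ^ N₀ := pow_pos hMP0 _
  have hpos2 : (0 : ℝ) < MQ ^ N₁ := pow_pos hMQ0 _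
  calc Real.log (∑ n ∈ L.intF.support, |((coeff n L.intF : ℤ) : ℝ)|)
      ≤ Real.log ((N.factorial : ℝ) * (MP ^ N₀ * MQ ^ N₁)) :=
        Real.log_le_log (lt_of_lt_of_le one_pos hlen1) hlen2
    _ = Real.log (N.factorial : ℝ) + N₀ * Real.log MP + N₁ * Real.log MQ := by
        rw [Real.log_mul hfact.ne' (mul_pos hpos1 hpos2).ne', Real.log_mul hpos1.ne' hpos2.ne',
          Real.log_pow, Real.log_pow, add_assoc]

end PairPkg

/-! ### Values of translates: `(ΦⁱP)(v) = P(τ̲ⁱ v)` -/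

/-- `(Φ_{ρ,θ} P)(v) = P(v₀, ρv₀ + v₁, θv₂)` for every `v ∈ ℂ³`. [cite: NguyenRoy2016, §2
(`Φ(P)(z) = P(τ̲ z)`)] -/
theorem eval_tau_vec (ρ θ : ℂ) (v : V3) (P : CX) :
    eval v (tau ρ θ P) = eval ![v 0, ρ * v 0 + v 1, θ * v 2] P := by
  induction P using MvPolynomial.induction_on with
  | C a => simp [tau]
  | add p q hp hq => rw [map_add, map_add, hp, hq, map_add]
  | mul_X p i hp =>
    rw [map_mul, map_mul, hp, map_mul, eval_X]
    congr 1
    fin_cases i <;> simp [tau]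

/-- Composition of the closed forms: `τ̲ʲ(τ̲ⁱ v) = τ̲^{j+i} v`. [cite: NguyenRoy2016, §2] -/
theorem tauMatPow_mulVec_tauMatPow (r : ℂ) {s : ℂ} (hs : s ≠ 0) (i j : ℤ) (v : V3) :
    tauMatPow r s j *ᵥ (tauMatPow r s i *ᵥ v) = tauMatPow r s (j + i) *ᵥ v := by
  rw [← tauMat_zpow r hs, ← tauMat_zpow r hs, ← tauMat_zpow r hs, Matrix.mulVec_mulVec,
    ← Matrix.zpow_add (isUnit_det_tauMat r hs)]

/-- **`(ΦⁱP)(v) = P(τ̲ⁱ v)`** with `Φⁱ = τ_{(ir, sⁱ)}` (`tau_iterate_eq`) and `τ̲ⁱ = tauMatPow r s i`.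
[cite: NguyenRoy2016, §2 (`Φʲ(P)(τ̲ⁱ(z)) = Φ^{i+j}(P)(z)`)] -/
theorem eval_tau_pow (r s : ℂ) (i : ℕ) (v : V3) (P : CX) :
    eval v (tau (i * r) (s ^ i) P) = eval (tauMatPow r s i *ᵥ v) P := by
  rw [eval_tau_vec, tauMatPow_mulVec]
  congr 1

/-- `Φʲ(P)(τ̲ⁱ v) = P(τ̲^{i+j} v)`. [cite: NguyenRoy2016, §2] -/
theorem eval_tauMatPow_tau_pow (r : ℂ) {s : ℂ} (hs : s ≠ 0) (i j : ℕ) (v : V3) (P : CX) :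
    eval (tauMatPow r s i *ᵥ v) (tau (j * r) (s ^ j) P) = eval (tauMatPow r s (i + j : ℕ) *ᵥ v) P := by
  rw [eval_tau_pow, tauMatPow_mulVec_tauMatPow r hs]
  have h : ((j : ℤ) + i) = ((i + j : ℕ) : ℤ) := by omega
  rw [h]

/-! ### The Nguyen–Roy companion form `Q = ∑ tⁱ ΦⁱP̃` -/

/-- **`Q = ∑_{i=1}^{D} tⁱ Qᵢ ∈ ℤ[X]`** for integral models `Qᵢ` of the translates `ΦⁱP̃`
(Proposition 4 makes `ΦⁱP̃_D` integral for `0 ≤ i < 4⌊D^σ⌋ `; here only `i ≤ D` is used).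
[cite: NguyenRoy2016, proof of Proposition 14 (`Q := ∑ aᵢ Φⁱ(P)`)] -/
def compQ (D : ℕ) (Qi : ℕ → MvPolynomial (Fin 3) ℤ) (t : ℕ) : MvPolynomial (Fin 3) ℤ :=
  ∑ i ∈ Icc 1 D, ((t : ℤ) ^ i) • Qi i

section compQ

variable {D : ℕ} {Pt : MvPolynomial (Fin 3) ℤ} {Qi : ℕ → MvPolynomial (Fin 3) ℤ} {ρ θ : ℂ}

/-- Its complexification is `∑ tⁱ Φⁱ P̃`. [cite: NguyenRoy2016, proof of Proposition 14] -/
theorem map_compQ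
    (hQi : ∀ i ∈ Icc 1 D, map (Int.castRingHom ℂ) (Qi i) =
      tau (i * ρ) (θ ^ i) (map (Int.castRingHom ℂ) Pt)) (t : ℕ) :
    map (Int.castRingHom ℂ) (compQ D Qi t) =
      ∑ i ∈ Icc 1 D, ((t : ℂ) ^ i) • (tau ρ θ)^[i] (map (Int.castRingHom ℂ) Pt) := by
  rw [compQ, map_sum]
  refine Finset.sum_congr rfl fun i hi => ?_
  rw [map_zsmul, hQi i hi, tau_iterate_eq, ← Int.cast_smul_eq_zsmul ℂ]
  push_cast
  rfl

/-- `Q` is a form of degree `D` over `ℂ`. [folklore] -/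
theorem isHomogeneous_map_compQ (hPt : (map (Int.castRingHom ℂ) Pt).IsHomogeneous D)
    (hQi : ∀ i ∈ Icc 1 D, map (Int.castRingHom ℂ) (Qi i) =
      tau (i * ρ) (θ ^ i) (map (Int.castRingHom ℂ) Pt)) (t : ℕ) :
    (map (Int.castRingHom ℂ) (compQ D Qi t)).IsHomogeneous D := by
  rw [map_compQ hQi]
  refine IsHomogeneous.sum _ _ _ fun i _ => ?_
  rw [smul_eq_C_mul, tau_iterate_eq]
  simpa using (isHomogeneous_C (Fin 3) ((t : ℂ) ^ i)).mul (isHomogeneous_tau _ _ hPt)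

/-- `Q` is a form of degree `D` over `ℤ` when the `Qᵢ` are. [folklore] -/
theorem isHomogeneous_compQ (hQih : ∀ i ∈ Icc 1 D, (Qi i).IsHomogeneous D) (t : ℕ) :
    (compQ D Qi t).IsHomogeneous D := by
  rw [compQ]
  refine IsHomogeneous.sum _ _ _ fun i hi => ?_
  rw [zsmul_eq_mul]
  simpa using ((isHomogeneous_C (Fin 3) ((t : ℤ) ^ i)).mul (hQih i hi))

/-- **A companion `Q = ∑ tⁱΦⁱP̃` coprime to `P̃` with `0 ≤ t ≤ D²`** (for `P̃ ∈ ℤ[X]_D` with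
`X₀ ∤ P̃`, `X₂ ∤ P̃`, and a rational translation `(r, s)`, `r ≠ 0`, `s ≠ 0, ±1`): Lemma 13 and a
counting argument modulo the prime factors of `P̃`.
[cite: NguyenRoy2016, proof of Proposition 14 (the integers `a₁, …, a_D` with `|aᵢ| ≤ D`; here `aᵢ = tⁱ`)] -/
theorem exists_coprime_compQ (hPt : (map (Int.castRingHom ℂ) Pt).IsHomogeneous D)
    (hPt0 : map (Int.castRingHom ℂ) Pt ≠ 0) (hX0 : ¬(X 0 : CX) ∣ map (Int.castRingHom ℂ) Pt)
    (hX2 : ¬(X 2 : CX) ∣ map (Int.castRingHom ℂ) Pt) {r s : ℚ} (hr : r ≠ 0) (hs0 : s ≠ 0)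
    (hs1 : s ≠ 1) (hs2 : s ≠ -1)
    (hQi : ∀ i ∈ Icc 1 D, map (Int.castRingHom ℂ) (Qi i) =
      tau (i * (r : ℂ)) ((s : ℂ) ^ i) (map (Int.castRingHom ℂ) Pt)) :
    ∃ t : ℕ, t ≤ D ^ 2 ∧
      IsRelPrime (map (Int.castRingHom ℂ) Pt) (map (Int.castRingHom ℂ) (compQ D Qi t)) := by
  obtain ⟨t, ht, hrel⟩ := exists_coprime_tau_combination_rat hPt hPt0 hX0 hX2 hr hs0 hs1 hs2
  exact ⟨t, ht, by rwa [map_compQ hQi]⟩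

/-- **`‖Q‖ ≤ D (D²)^D max‖Qᵢ‖`** for `t ≤ D²` (maximum norm of the coefficients, over `ℂ`).
[cite: NguyenRoy2016, proof of Proposition 14 (`h(W) ≤ D log‖P‖ + D log‖Q‖ + O(D²)`, `‖Q‖` from `|aᵢ| ≤ D`)] -/
theorem maxNorm_map_compQ_le {B : ℝ}
    (hQn : ∀ i ∈ Icc 1 D, maxNorm (map (Int.castRingHom ℂ) (Qi i)) ≤ B) {t : ℕ} (ht : t ≤ D ^ 2) :
    maxNorm (map (Int.castRingHom ℂ) (compQ D Qi t)) ≤ D * ((D : ℝ) ^ 2) ^ D * B := by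
  rw [compQ, map_sum]
  refine (maxNorm_sum_le _ _).trans ?_
  have hterm : ∀ i ∈ Icc 1 D,
      maxNorm (map (Int.castRingHom ℂ) (((t : ℤ) ^ i) • Qi i)) ≤ ((D : ℝ) ^ 2) ^ D * B := by
    intro i hi
    have hiD : i ≤ D := (mem_Icc.mp hi).2
    rw [map_zsmul, zsmul_eq_mul, ← map_intCast (C : ℂ →+* CX), Int.cast_pow, Int.cast_natCast]
    refine (maxNorm_C_mul_le _ _).trans ?_
    have hnorm : ‖((t : ℂ)) ^ i‖ = (t : ℝ) ^ i := by
      rw [norm_pow, Complex.norm_natCast]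
    rw [hnorm]
    have ht' : (t : ℝ) ≤ (D : ℝ) ^ 2 := by exact_mod_cast ht
    have hti : (t : ℝ) ^ i ≤ ((D : ℝ) ^ 2) ^ D := by
      by_cases hD0 : D = 0
      · subst hD0
        have : i = 0 := by omega
        subst this
        simp
      · calc (t : ℝ) ^ i ≤ ((D : ℝ) ^ 2) ^ i := pow_le_pow_left₀ (Nat.cast_nonneg _) ht' i
          _ ≤ ((D : ℝ) ^ 2) ^ D := by
              refine pow_le_pow_right₀ ?_ hiD
              have h1 : (1 : ℝ) ≤ D := by exact_mod_cast Nat.one_le_iff_ne_zero.mpr hD0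
              nlinarith
    exact mul_le_mul hti (hQn i hi) (maxNorm_nonneg _) (by positivity)
  calc ∑ i ∈ Icc 1 D, maxNorm (map (Int.castRingHom ℂ) (((t : ℤ) ^ i) • Qi i))
      ≤ ∑ i ∈ Icc 1 D, ((D : ℝ) ^ 2) ^ D * B := sum_le_sum hterm
    _ = D * (((D : ℝ) ^ 2) ^ D * B) := by
        rw [sum_const, Nat.card_Icc, nsmul_eq_mul]
        push_cast
        ring
    _ = D * ((D : ℝ) ^ 2) ^ D * B := by ring

/-- **Vanishing of `Q` at a point whose translates `τ̲ʲv`, `i + 1 ≤ j ≤ i + D`, are zeros of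
`P̃`**: `Q(τ̲ⁱv) = ∑ tʲ P̃(τ̲^{i+j} v) = 0`. [cite: NguyenRoy2016, proof of Proposition 14 (`τⁱ(Z) ⊆ W`)] -/
theorem eval_compQ_translate_eq_zero {r s : ℂ} (hs : s ≠ 0)
    (hQi : ∀ j ∈ Icc 1 D, map (Int.castRingHom ℂ) (Qi j) =
      tau (j * r) (s ^ j) (map (Int.castRingHom ℂ) Pt)) (t i : ℕ) {v : V3}
    (hv : ∀ j ∈ Icc 1 D, eval (tauMatPow r s (i + j : ℕ) *ᵥ v) (map (Int.castRingHom ℂ) Pt) = 0) :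
    eval (tauMatPow r s i *ᵥ v) (map (Int.castRingHom ℂ) (compQ D Qi t)) = 0 := by
  rw [compQ, map_sum, map_sum]
  refine Finset.sum_eq_zero fun j hj => ?_
  rw [map_zsmul, zsmul_eq_mul, map_mul, hQi j hj, eval_tauMatPow_tau_pow r hs, hv j hj, mul_zero]

/-- **`τⁱ(Z) ⊆ W` for `0 ≤ i < T`**: if `P̃(τ̲ʲ v) = 0` for all `0 ≤ j < 2T` (i.e. `[v] ∈ W_D =
𝒵(ΦʲP̃; 0 ≤ j < 2T)`) and `D ≤ T`, then every translate `τ̲ⁱv`, `0 ≤ i < T`, is a common zero of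
`P̃` and `Q`. [cite: NguyenRoy2016, proof of Proposition 14 ("Since `D ≤ T`, we have `τⁱ(Z) ⊆ W`
for `i = 0, …, T − 1`")] -/
theorem common_zero_of_translates {r s : ℂ} (hs : s ≠ 0)
    (hQi : ∀ j ∈ Icc 1 D, map (Int.castRingHom ℂ) (Qi j) =
      tau (j * r) (s ^ j) (map (Int.castRingHom ℂ) Pt)) (t : ℕ) {T : ℕ} (hDT : D ≤ T) {v : V3}
    (hW : ∀ j : ℕ, j < 2 * T → eval (tauMatPow r s j *ᵥ v) (map (Int.castRingHom ℂ) Pt) = 0)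
    {i : ℕ} (hi : i < T) :
    eval (tauMatPow r s i *ᵥ v) (map (Int.castRingHom ℂ) Pt) = 0 ∧
      eval (tauMatPow r s i *ᵥ v) (map (Int.castRingHom ℂ) (compQ D Qi t)) = 0 := by
  refine ⟨hW i (by omega), eval_compQ_translate_eq_zero hs hQi t i fun j hj => ?_⟩
  have hjD : j ≤ D := (mem_Icc.mp hj).2
  exact hW (i + j) (by omega)

end compQ

/-! ### The Nguyen–Roy level package -/

/-- **The data attached to a level `D` of the Nguyen–Roy proof**: the parameter `t ≤ D²` of the
companion `Q = ∑ tⁱΦⁱP̃` and the package of the coprime pair `(P̃, Q)`.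
[cite: NguyenRoy2016, proof of Proposition 14] -/
structure TransPkg (D : ℕ) (Pt : MvPolynomial (Fin 3) ℤ) (Qi : ℕ → MvPolynomial (Fin 3) ℤ) where
  /-- the parameter of `Q` -/
  t : ℕ
  ht : t ≤ D ^ 2
  /-- the package of `(P̃, Q)` -/
  pkg : PairPkg D Pt (compQ D Qi t)

/-- **The level package exists** for `P̃ ∈ ℤ[X]_D` (`D ≥ 1`) with `X₀ ∤ P̃`, `X₂ ∤ P̃`, integral
models `Qᵢ` of `ΦⁱP̃` (`1 ≤ i ≤ D`) and a rational translation `(r, s)` with `r ≠ 0`, `s ≠ 0, ±1`.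
[cite: NguyenRoy2016, proof of Proposition 14] -/
theorem nonempty_transPkg {D : ℕ} (hD : 1 ≤ D) {Pt : MvPolynomial (Fin 3) ℤ}
    {Qi : ℕ → MvPolynomial (Fin 3) ℤ} (hPt : (map (Int.castRingHom ℂ) Pt).IsHomogeneous D)
    (hPt0 : map (Int.castRingHom ℂ) Pt ≠ 0) (hX0 : ¬(X 0 : CX) ∣ map (Int.castRingHom ℂ) Pt)
    (hX2 : ¬(X 2 : CX) ∣ map (Int.castRingHom ℂ) Pt) {r s : ℚ} (hr : r ≠ 0) (hs0 : s ≠ 0)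
    (hs1 : s ≠ 1) (hs2 : s ≠ -1)
    (hQi : ∀ i ∈ Icc 1 D, map (Int.castRingHom ℂ) (Qi i) =
      tau (i * (r : ℂ)) ((s : ℂ) ^ i) (map (Int.castRingHom ℂ) Pt)) :
    Nonempty (TransPkg D Pt Qi) := by
  obtain ⟨t, ht, hrel⟩ := exists_coprime_compQ hPt hPt0 hX0 hX2 hr hs0 hs1 hs2 hQi
  obtain ⟨L⟩ := nonempty_pairPkg hD hPt (isHomogeneous_map_compQ hPt hQi t) hPt0 hrel
  exact ⟨⟨t, ht, L⟩⟩

/-- Divisibility by a variable is visible on the support: a form with a monomial free of `X_k` is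
not divisible by `X_k` (the shape in which `NguyenRoy.prop4` states `X₀ ∤ P̃_D`, `X₂ ∤ P̃_D`).
[folklore] -/
theorem not_X_dvd_of_mem_support {Pt : MvPolynomial (Fin 3) ℤ} {k : Fin 3}
    (h : ∃ e ∈ Pt.support, e k = 0) : ¬(X k : CX) ∣ map (Int.castRingHom ℂ) Pt := by
  rintro ⟨R, hR⟩
  obtain ⟨e, he, hek⟩ := h
  have hcoef : coeff e (map (Int.castRingHom ℂ) Pt) ≠ 0 := by
    rw [coeff_map, Ne, eq_intCast, Int.cast_eq_zero]
    exact mem_support_iff.mp he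
  rw [hR, coeff_X_mul', if_neg (by simp [hek])] at hcoef
  exact hcoef rfl

end NguyenRoy

end Literature.NumberTheory.Transcendental
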